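import Summits.CriticalPhenomena.PercolationContinuityZ3.Theorems.Transplant.SiteSetRestrict
import Literature.Probability.Percolation.SetClusterExploration
import HarnessLib

/-!
# SITE percolation: the full exploration of the site cluster of a vertex SET by vertex states, its decision tree, and the
# decision-tree Harris–Kleitman inequality along it (WP3 step 1 of P1-SITE-Z3 §16; site twin of `L/SetClusterExploration.lean`)

builds on p205010 (kernel theorem, internal audit signed; external expert review pending).

Coordinates are VERTICES (`ι = V`): a configuration is the finite set `K ⊆ D` of open vertices of the world `D : Finset V`.  The exploration
of the cluster of the source set `N` reveals, one vertex at a time, an unrevealed vertex of `D` which is a source or is adjacent to a reached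
(open, revealed, joined to `N`) vertex; an open revealed vertex becomes reached.  THIS FILE (part 1): states, `bnd`/`step`/`run`/`fin`,
`reached`, `revealedAt`, the invariant `Inv` and its preservation, termination `bnd_fin`.  Part 2 (`SiteSetExplorationWorld`): what is revealed
(= sources ∪ cluster ∪ vertex boundary, the complement of the site world `SiteBHK.srest`), self-determination, the hybrid.  Part 3
(`SiteSetExplorationHK`): the decision tree and Gladkov's Theorem 3.2 along it (generic layer `L/DecisionTreeWeighted`, `ι = V`).
Definitions + proofs (`--supports stmt-CriticalPhenomena-4575 --as helper`); no named facts, no sorries.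
[cite: Gladkov2024, Def. 2.4, Example 2.5, Lemma 3.1, Thm. 3.2 (p. 4)] [cite: VandenbergHaggstromKahn2005, §1 p. 4, eq. (6)]
-/

noncomputable section

open Classical

namespace Summit.CriticalPhenomena.PercolationContinuityZ3.Theorems.Transplant

namespace SiteSetExploration

open Finset
open Literature.Probability.Percolation
open Literature.Probability.Percolation.DecisionTree
open SiteBHK (sC)

variable {V : Type*} [Fintype V] [DecidableEq V] (Γ : SimpleGraph V)

/-! ### States and the exploration -/

/-- A state of the site exploration: the reached (open, joined to the sources) vertices and the revealed vertices. [cite: Gladkov2024, §2 Example 2.5] -/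
structure SSt (V : Type*) where
  /-- the reached vertices: revealed, open, joined to a source through reached vertices -/
  vis : Finset V
  /-- the revealed (queried) vertices -/
  rev : Finset V

/-- A choice of an element of a nonempty finset. [folklore] -/
def pickV (s : Finset V) : Option V := if h : s.Nonempty then some h.choose else none

omit [Fintype V] [DecidableEq V] in
/-- `pickV s = none` iff `s = ∅`. [folklore] -/
theorem pickV_eq_none_iff {s : Finset V} : pickV s = none ↔ s = ∅ := by
  unfold pickV
  split_ifs with h
  · simp only [false_iff]; exact h.ne_empty
  · simp only [true_iff]; exact Finset.not_nonempty_iff_eq_empty.1 h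

omit [Fintype V] [DecidableEq V] in
/-- The picked element belongs to the finset. [folklore] -/
theorem mem_of_pickV_eq_some {s : Finset V} {u : V} (h : pickV s = some u) : u ∈ s := by
  unfold pickV at h
  split_ifs at h with hs
  rw [Option.some.injEq] at h
  exact h ▸ hs.choose_spec

section Defs

variable (D : Finset V) (N : Finset V)

/-- The boundary of a state: unrevealed vertices of `D` which are sources or adjacent to a reached vertex. [cite: Gladkov2024, §2 Example 2.5] -/
def bnd (σ : SSt V) : Finset V := (D \ σ.rev).filter fun u => u ∈ N ∨ ∃ r ∈ σ.vis, Γ.Adj r u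

/-- One step on the configuration `K` (open vertices): reveal a boundary vertex (if any); if it is open, it is reached.
[cite: Gladkov2024, §2 Example 2.5] -/
def step (K : Finset V) (σ : SSt V) : SSt V :=
  match pickV (bnd Γ D N σ) with
  | none => σ
  | some u => if u ∈ K then ⟨insert u σ.vis, insert u σ.rev⟩ else ⟨σ.vis, insert u σ.rev⟩

/-- The initial state: nothing reached, nothing revealed (the sources are revealed first). [folklore] -/
def init : SSt V := ⟨∅, ∅⟩

/-- The state after `k` steps. [cite: Gladkov2024, §2 Example 2.5] -/
def run (K : Finset V) : ℕ → SSt V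
  | 0 => init
  | k + 1 => step Γ D N K (run K k)

/-- The final state (fuel `#D + 1`). [folklore] -/
def fin (K : Finset V) : SSt V := run Γ D N K (D.card + 1)

/-- The reached set of the full exploration. [folklore] -/
def reached (K : Finset V) : Finset V := (fin Γ D N K).vis

/-- The revealed vertex set `S_N(K)` of the full exploration. [cite: Gladkov2024, Def. 2.4] -/
def revealedAt (K : Finset V) : Finset V := (fin Γ D N K).rev

end Defs

/-! ### Basic facts about one step -/

section Basic

variable {Γ} {D : Finset V} {N : Finset V}

omit [Fintype V] in
/-- Membership in the boundary. [folklore] -/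
theorem mem_bnd {σ : SSt V} {u : V} :
    u ∈ bnd Γ D N σ ↔ (u ∈ D ∧ u ∉ σ.rev) ∧ (u ∈ N ∨ ∃ r ∈ σ.vis, Γ.Adj r u) := by
  simp [bnd, mem_filter, mem_sdiff]

omit [Fintype V] in
/-- With an empty boundary a step does nothing. [folklore] -/
theorem step_of_bnd_eq_empty {K : Finset V} {σ : SSt V} (h : bnd Γ D N σ = ∅) : step Γ D N K σ = σ := by
  unfold step
  rw [pickV_eq_none_iff.2 h]

omit [Fintype V] in
/-- With a nonempty boundary a step reveals the picked boundary vertex. [folklore] -/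
theorem step_of_bnd_ne_empty {K : Finset V} {σ : SSt V} (h : bnd Γ D N σ ≠ ∅) :
    ∃ u ∈ bnd Γ D N σ, pickV (bnd Γ D N σ) = some u ∧
      step Γ D N K σ = (if u ∈ K then ⟨insert u σ.vis, insert u σ.rev⟩ else ⟨σ.vis, insert u σ.rev⟩) := by
  unfold step
  cases hp : pickV (bnd Γ D N σ) with
  | none => exact absurd (pickV_eq_none_iff.1 hp) h
  | some u => exact ⟨u, mem_of_pickV_eq_some hp, rfl, rfl⟩

omit [Fintype V] in
/-- The revealed set grows by one step. [folklore] -/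
theorem rev_subset_step (K : Finset V) (σ : SSt V) : σ.rev ⊆ (step Γ D N K σ).rev := by
  by_cases h : bnd Γ D N σ = ∅
  · rw [step_of_bnd_eq_empty h]
  · obtain ⟨u, -, -, hstep⟩ := step_of_bnd_ne_empty (K := K) h
    rw [hstep]
    split_ifs <;> exact subset_insert u σ.rev

omit [Fintype V] in
/-- With a nonempty boundary the revealed set grows strictly. [folklore] -/
theorem card_rev_step {K : Finset V} {σ : SSt V} (h : bnd Γ D N σ ≠ ∅) :
    σ.rev.card + 1 ≤ (step Γ D N K σ).rev.card := by
  obtain ⟨u, hu, -, hstep⟩ := step_of_bnd_ne_empty (K := K) h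
  have hurev : u ∉ σ.rev := ((mem_bnd.1 hu).1).2
  rw [hstep]
  split_ifs <;> simp [card_insert_of_notMem hurev]

omit [Fintype V] in
/-- `run (k+1) = step (run k)`. [folklore] -/
theorem run_succ (K : Finset V) (k : ℕ) : run Γ D N K (k + 1) = step Γ D N K (run Γ D N K k) := rfl

end Basic

/-! ### The invariant -/

/-- The invariant of the site exploration: revealed ⊆ `D`; reached vertices are revealed and open; every revealed vertex is a source or adjacent
to a reached vertex; open revealed vertices are reached; reached vertices are joined to a reached source through reached vertices.
[cite: Gladkov2024, §6.2] -/
def Inv (Γ : SimpleGraph V) (D : Finset V) (N : Finset V) (K : Finset V) (σ : SSt V) : Prop :=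
  σ.rev ⊆ D ∧ (∀ v ∈ σ.vis, v ∈ σ.rev ∧ v ∈ K) ∧ (∀ u ∈ σ.rev, u ∈ N ∨ ∃ r ∈ σ.vis, Γ.Adj r u) ∧
    (∀ u ∈ σ.rev, u ∈ K → u ∈ σ.vis) ∧ (∀ v ∈ σ.vis, ∃ s ∈ N, s ∈ σ.vis ∧ (siteOpenGraph Γ (↑σ.vis : Set V)).Reachable s v)

namespace Inv

variable {Γ} {D N K : Finset V} {σ : SSt V}

omit [Fintype V] [DecidableEq V] in
/-- Only vertices of `D` are revealed. [folklore] -/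
theorem rev_sub (h : Inv Γ D N K σ) : σ.rev ⊆ D := h.1

omit [Fintype V] [DecidableEq V] in
/-- Reached vertices are revealed and open. [folklore] -/
theorem vis_sub (h : Inv Γ D N K σ) : ∀ v ∈ σ.vis, v ∈ σ.rev ∧ v ∈ K := h.2.1

omit [Fintype V] [DecidableEq V] in
/-- Every revealed vertex is a source or adjacent to a reached vertex. [folklore] -/
theorem touch (h : Inv Γ D N K σ) : ∀ u ∈ σ.rev, u ∈ N ∨ ∃ r ∈ σ.vis, Γ.Adj r u := h.2.2.1

omit [Fintype V] [DecidableEq V] in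
/-- Open revealed vertices are reached. [folklore] -/
theorem open_vis (h : Inv Γ D N K σ) : ∀ u ∈ σ.rev, u ∈ K → u ∈ σ.vis := h.2.2.2.1

omit [Fintype V] [DecidableEq V] in
/-- Reached vertices are joined to a reached source through reached vertices. [folklore] -/
theorem reach (h : Inv Γ D N K σ) :
    ∀ v ∈ σ.vis, ∃ s ∈ N, s ∈ σ.vis ∧ (siteOpenGraph Γ (↑σ.vis : Set V)).Reachable s v := h.2.2.2.2

end Inv

section Invariant

variable {Γ} {D : Finset V} {N : Finset V} {K : Finset V}

omit [Fintype V] [DecidableEq V] in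
/-- The initial state satisfies the invariant. [folklore] -/
theorem inv_init : Inv Γ D N K (init : SSt V) := by
  refine ⟨?_, ?_, ?_, ?_, ?_⟩ <;> simp [init]

omit [Fintype V] in
/-- **The invariant is preserved by a step.** [cite: Gladkov2024, §6.2] -/
theorem inv_step {σ : SSt V} (hσ : Inv Γ D N K σ) : Inv Γ D N K (step Γ D N K σ) := by
  by_cases h : bnd Γ D N σ = ∅
  · rw [step_of_bnd_eq_empty h]; exact hσ
  obtain ⟨u, hu, -, hstep⟩ := step_of_bnd_ne_empty (K := K) h
  obtain ⟨⟨huD, hurev⟩, hsrc⟩ := mem_bnd.1 hu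
  rw [hstep]
  split_ifs with hK
  · -- the revealed vertex is open: it is reached
    have hmono : siteOpenGraph Γ (↑σ.vis : Set V) ≤ siteOpenGraph Γ (↑(insert u σ.vis) : Set V) :=
      SiteBHK.siteOpenGraph_mono (by rw [coe_insert]; exact Set.subset_insert _ _)
    refine ⟨insert_subset huD hσ.rev_sub, ?_, ?_, ?_, ?_⟩
    · intro v hv
      rcases mem_insert.1 hv with rfl | hv
      · exact ⟨mem_insert_self _ _, hK⟩
      · exact ⟨mem_insert_of_mem (hσ.vis_sub v hv).1, (hσ.vis_sub v hv).2⟩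
    · intro w hw
      rcases mem_insert.1 hw with rfl | hw
      · rcases hsrc with hN | ⟨r, hr, hrw⟩
        · exact Or.inl hN
        · exact Or.inr ⟨r, mem_insert_of_mem hr, hrw⟩
      · rcases hσ.touch w hw with hN | ⟨r, hr, hrw⟩
        · exact Or.inl hN
        · exact Or.inr ⟨r, mem_insert_of_mem hr, hrw⟩
    · intro w hw hwK
      rcases mem_insert.1 hw with rfl | hw
      · exact mem_insert_self _ _
      · exact mem_insert_of_mem (hσ.open_vis w hw hwK)
    · intro v hv
      rcases mem_insert.1 hv with rfl | hv
      · rcases hsrc with hN | ⟨r, hr, hrv⟩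
        · exact ⟨v, hN, mem_insert_self _ _, SimpleGraph.Reachable.refl _⟩
        · obtain ⟨s, hs, hsvis, hsr⟩ := hσ.reach r hr
          refine ⟨s, hs, mem_insert_of_mem hsvis, (hsr.mono hmono).trans (SimpleGraph.Adj.reachable ?_)⟩
          rw [siteOpenGraph_adj]
          exact ⟨hrv, by rw [coe_insert]; exact Set.mem_insert_of_mem _ hr, by rw [coe_insert]; exact Set.mem_insert _ _⟩
      · obtain ⟨s, hs, hsvis, hsv⟩ := hσ.reach v hv
        exact ⟨s, hs, mem_insert_of_mem hsvis, hsv.mono hmono⟩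
  · -- the revealed vertex is closed
    refine ⟨insert_subset huD hσ.rev_sub, ?_, ?_, ?_, hσ.reach⟩
    · intro v hv
      exact ⟨mem_insert_of_mem (hσ.vis_sub v hv).1, (hσ.vis_sub v hv).2⟩
    · intro w hw
      rcases mem_insert.1 hw with rfl | hw
      · exact hsrc
      · exact hσ.touch w hw
    · intro w hw hwK
      rcases mem_insert.1 hw with rfl | hw
      · exact absurd hwK hK
      · exact hσ.open_vis w hw hwK

omit [Fintype V] in
/-- The invariant holds along the run. [folklore] -/
theorem inv_run (K : Finset V) : ∀ k, Inv Γ D N K (run Γ D N K k)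
  | 0 => inv_init
  | k + 1 => inv_step (inv_run K k)

omit [Fintype V] in
/-- The invariant holds at the final state. [folklore] -/
theorem inv_fin (K : Finset V) : Inv Γ D N K (fin Γ D N K) := inv_run K _

/-! ### Termination -/

omit [Fintype V] in
/-- Either the boundary is empty by time `k`, or at least `k` vertices have been revealed. [folklore] -/
theorem bnd_empty_or_le_card (K : Finset V) :
    ∀ k, bnd Γ D N (run Γ D N K k) = ∅ ∨ k ≤ (run Γ D N K k).rev.card
  | 0 => Or.inr (Nat.zero_le _)
  | k + 1 => by
      by_cases h : bnd Γ D N (run Γ D N K k) = ∅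
      · left; rw [run_succ, step_of_bnd_eq_empty h]; exact h
      · rcases bnd_empty_or_le_card K k with h' | h'
        · exact absurd h' h
        · exact Or.inr (le_trans (Nat.add_le_add_right h' 1) (card_rev_step h))

omit [Fintype V] in
/-- **The exploration is complete at the final state.** [folklore] -/
theorem bnd_fin (K : Finset V) : bnd Γ D N (fin Γ D N K) = ∅ := by
  rcases bnd_empty_or_le_card (Γ := Γ) (D := D) (N := N) K (D.card + 1) with h | h
  · exact h
  · exact absurd ((card_le_card (inv_fin (Γ := Γ) (D := D) (N := N) K).rev_sub).trans_lt
      (Nat.lt_of_succ_le h)) (lt_irrefl _)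

end Invariant

end SiteSetExploration

end Summit.CriticalPhenomena.PercolationContinuityZ3.Theorems.Transplant
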